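import Summits.QuantumAdvantage.QuantumAdvantage.Theorems.WbwObfuscatedGluedTrees.Negative.GrowthClosure

/-!
# `WbwObfuscatedGluedTrees` (stmt-QuantumAdvantage-2340) — IV: any plant-and-grow SEQUENCE kills exactly one round

Support / negative lemma for the INFORMAL crux `WbwObfuscatedGluedTrees` of route
`Summits/QuantumAdvantage/QuantumAdvantage/Theses/WhiteBoxWalk`, extracted from the refuter work file
`Summits/QuantumAdvantage/QuantumAdvantage/Cruxes/WbwObfuscatedGluedTrees/Disproof.lean` (§3, cycle 1;
filed in cycle 2 by refuter-cdisprove-stmt-QuantumAdvantage-2340-g2-0). Sequel of `GrowthClosure.lean`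
(II), whose `Percolation.oneRound` / `exit_mem_oneRound_iff` it imports. Sorry-free; no Theses decl
is asserted.

`GrowthClosure.lean` characterises the least growth-CLOSED superset of a planted set `S` (the
fixed point of the Bitansky–Paneth–Rosen growth rule "a name may be punctured once every input that
PRODUCES it is dead", FOCS 2015 §5, Claim 5.1(3–6)) as ONE round `S ∪ {v | N(v) ⊆ S}`. A hybrid
chain, however, is a SEQUENCE of steps, so the operationally relevant object is the inductively
generated dead set: plants (`v ∈ S`) and growth steps (a vertex with a neighbour, all of whose
neighbours are already dead). `killed_iff_mem_oneRound` shows the two coincide — no interleaving of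
plants-from-`S` and growth steps ever kills more than the one round — and `killed_exit_iff`
specialises to the glued trees: EXIT is killed by some sequence over `S` iff EXIT is planted or BOTH
its children are (publicly labelled positions adjacent to the answer).
-/

set_option linter.dupNamespace false

namespace Summit.QuantumAdvantage.QuantumAdvantage.Theorems.WbwObfuscatedGluedTrees.Negative

open Literature.Computability.QuantumComplexity

namespace Percolation

variable {V : Type*} (G : SimpleGraph V)

/-- The dead set generated by ANY sequence of steps of the BPR template over the planted set `S`:
plants (`v ∈ S`) and growth steps (a vertex with at least one neighbour, all of whose neighbours
are already dead, dies — its name is produced by nobody alive and can be punctured). [folklore] -/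
inductive Killed (S : Set V) : V → Prop
  | plant {v : V} (hv : v ∈ S) : Killed S v
  | grow {v : V} (hex : ∃ w, G.Adj v w) (hall : ∀ w, G.Adj v w → Killed S w) : Killed S v

/-- **Any plant-and-grow sequence kills exactly one round**: `Killed G S v ↔ v ∈ oneRound G S`
(`= S ∪ {v | v has a neighbour ∧ N(v) ⊆ S}`). [folklore] -/
theorem killed_iff_mem_oneRound (S : Set V) (v : V) : Killed G S v ↔ v ∈ oneRound G S := by
  constructor
  · intro h
    induction h with
    | plant hv => exact Or.inl hv
    | grow hex _ ih => exact (oneRound_isGrowthClosed G S).2 _ hex ih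
  · rintro (hv | ⟨hex, hall⟩)
    · exact Killed.plant hv
    · exact Killed.grow hex fun w hw => Killed.plant (hall w hw)

/-- The killed set is growth-closed (it is the one round). [folklore] -/
theorem isGrowthClosed_killed (S : Set V) : IsGrowthClosed G S {v | Killed G S v} := by
  have h : {v | Killed G S v} = oneRound G S := Set.ext fun v => killed_iff_mem_oneRound G S v
  rw [h]
  exact oneRound_isGrowthClosed G S

open GluedTrees in
/-- **For the glued trees** (`1 ≤ n`): EXIT is killed by some plant-and-grow sequence over `S` iff
EXIT is planted or BOTH children of EXIT are planted. [folklore] -/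
theorem killed_exit_iff {n : ℕ} (hn : 1 ≤ n) (σ : CycleDatum n) (S : Set (Vertex n)) :
    Killed (graph n σ) S (GluedTrees.exit n) ↔
      GluedTrees.exit n ∈ S ∨
        (childV (GluedTrees.exit n) false ∈ S ∧ childV (GluedTrees.exit n) true ∈ S) := by
  rw [killed_iff_mem_oneRound, exit_mem_oneRound_iff hn]

end Percolation

end Summit.QuantumAdvantage.QuantumAdvantage.Theorems.WbwObfuscatedGluedTrees.Negative
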